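import Literature.MathematicalPhysics.QuantumFieldTheory.Balaban1983to89.B14Thm2
import Literature.MathematicalPhysics.QuantumFieldTheory.Balaban1983to89.Node00.Record13CoPH

/-!
# DAG node N11 — [III] (2.47) ⇒ (2.48) AT THE ₁₃ OBJECTS: the boundary-term bound `|𝐁_k(U_k, A)| ≤ 2B₁ Σ_{n=1}^{k} |Γ_n|` (file 1's binder `h248`) for r11's (2.40)-sum `B240` of the
# record FROM the per-class sentence (2.47) p. 264 «|𝐁^{(j,n)}(U_k, A, {S_i})| ≤ B₁ 2^{−(j−n)} |Γ_n| for j > n, and this inequality with |Γ_n∖Λ_k⁰| for j = n»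

Cell `pub-ymgap`, YM-PLAN Track A (HUMAN RULING D-0062 ∕ D-0149), seat `pub-ymgap-dag-n11-w2` (g0), route `BalabanUVNodes`, key item K1⁷ `StabilityBAtRecordR13SepCoPH` =
stmt-QuantumFields-20542 (helper, count-neutral).  Companion of this seat's `BalabanUVNodesN11Thm2Ineq249AtRecord13CoPH` (file 1: binder `h248 : |B240 …| ≤ 2B₁ΣΓ`) and of the
𝐄-∕𝐑-side files.  [III] = [Balaban1988Convergent].

WHY THIS FILE.  p. 264: *«Bounds for the boundary terms (2.40) are even more elementary … Thus we obtain |𝐁^{(j,n)}(U_k, A, {S_i})| ≤ B₁2^{−(j−n)}|Γ_n| (2.47) for j > n, and this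
inequality with |Γ_n∖Λ_k⁰| for j = n. Summing over j from n to k, and then over n from 1 to k, we get |(2.40)| ≤ 2B₁(Σ_{n=1}^{k−1}|Γ_n| + |Γ_k∖Λ_k⁰|) ≤ 2B₁Σ_{n=1}^{k}|Γ_n|. (2.48)»*
The symbol `𝐁^{(j,n)}` is not defined in §2 (cell GAPS G-pv01-1 (i)): the printed summation PRESUPPOSES a decomposition of the scale-`j` boundary terms into classes `n = 1, …, j`.
The cell's `B14Thm2.bound248_of_247` types the summation over real arrays `b j n`.  THIS FILE performs it AT r11's (2.40)-sum of the record `B240 T admB a k U =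
Σ_{j=1}^{k} Σ_X admB·Re 𝐁^{(j)}(X, U, A)`: a CLASS MAP `cls j : 𝐃_j → ℕ` with values in `[1, j]` on the (2.41)(i) range (the presupposed decomposition, DISPLAYED), the per-class
sentence (2.47) with volumes `V_n ≤ Γ_n`, the exchange of the triangle `1 ≤ n ≤ j ≤ k` ⇒ file 1's `h248`.

WHAT THIS FILE PROVES (0 `sorry`, 0 `def`, standard axioms; count-neutral; nothing of Bałaban's asserted — (2.47) and the class map are HYPOTHESES, displayed).
§1 generic over any `Step.LFTower`: `sum_triangle_comm'` (`Σ_{j=1}^{k}Σ_{n=1}^{j} = Σ_{n=1}^{k}Σ_{j=n}^{k}`) · `B240_eq_sum_classes` (`B240 = Σ_{n=1}^{k}Σ_{j=n}^{k} b_{j,n}`, `b_{j,n}` := the class-`n`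
part of the scale-`j` boundary sum) · ★ `B240_abs_le_of_ineq247` ((2.47) per class + `0 ≤ V_n ≤ Γ_n` ⇒ `|B240| ≤ 2B₁Σ_{n=1}^{k}Γ_n`; kernel = `B14Thm2.bound248_of_247`).
§2 at the ₁₃ objects: ★★ `h248_at_record₁₃CoPH_of_ineq247` — file 1's binder `h248` for the witness's `t.B j X` over `𝐃_j` of record at `settingOfRecord₁₃`∕`θ.rzAt p s` and the
(2.41)(i) range `Sect2.admB … s.Ω s.Λ j`, from a class map and (2.47).

HONEST FRAMING.  Count-neutral kernel bookkeeping; (2.47) IS [III]'s («even more elementary», from (2.42)'s `exp(−κd_j(X))` — not derived here), the class map is the reader's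
reconstruction of the undefined `𝐁^{(j,n)}` (GAPS G-pv01-1 (i)).  N11 NOT discharged; K1⁷ NOT closed; counts unmoved (typed 28∕28 · discharged 5∕27).  One finite four-torus
programme at fixed `ε = L^{−K}`; R4 closes only the conditional finite-𝕋⁴ rung `BalabanLadder.UV`; NOT ℝ⁴, NOT OS, NOT a mass gap, NOT Clay.
Sources: [III] (2.40)–(2.42) p. 261, (2.47)–(2.48) p. 264.
-/

noncomputable section

open scoped BigOperators Matrix.Norms.L2Operator

namespace Summit.QuantumFields.YangMills.Theorems.BalabanUVNodesN11Thm2BSideAtRecord13CoPH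

open Literature.MathematicalPhysics.QuantumFieldTheory.Balaban1983to89 Step B14.Eq225Concrete B14Thm2 Finset
open T4Continuum Node00

/-! ## §1. Generic: `B240` split along a class map, the triangle exchanged, (2.47) per class ⇒ (2.48) -/

section Generic

/-- The other triangle: `Σ_{j=1}^{k} Σ_{n=1}^{j} f(j,n) = Σ_{n=1}^{k} Σ_{j=n}^{k} f(j,n)` («summing over j from n to k, and then over n from 1 to k»). [folklore] -/
theorem sum_triangle_comm' (k : ℕ) (f : ℕ → ℕ → ℝ) :
    ∑ j ∈ Icc 1 k, ∑ n ∈ Icc 1 j, f j n = ∑ n ∈ Icc 1 k, ∑ j ∈ Icc n k, f j n := by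
  apply Finset.sum_comm'
  intro j n
  simp only [Finset.mem_Icc]
  omega

variable {P : Params} {G : Type*} [GaugeGroup G] {Φ 𝒢 𝔄 : Type*}
variable (T : LFTower P G Φ 𝒢 𝔄) (admB : (j : ℕ) → (T.sys j).Dom → Bool)

/-- **`B240` SPLIT ALONG A CLASS MAP** `cls j : 𝐃_j → ℕ` with values in `[1, j]` on the (2.41)(i) range (the presupposed decomposition `𝐁^{(j)} = Σ_{n=1}^{j} 𝐁^{(j,n)}`, cell GAPS
G-pv01-1 (i)): `B240 T admB a k U = Σ_{n=1}^{k} Σ_{j=n}^{k} b_{j,n}` with `b_{j,n} = Σ_X (admB ∧ cls_j X = n)·Re 𝐁^{(j)}(X,U,A)`. [cite: Balaban1988Convergent, (2.40)–(2.41) p.261, (2.47)–(2.48) p.264] -/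
theorem B240_eq_sum_classes (cls : (j : ℕ) → (T.sys j).Dom → ℕ) (k : ℕ) (hcls : ∀ j, 1 ≤ j → j ≤ k → ∀ X, admB j X = true → 1 ≤ cls j X ∧ cls j X ≤ j)
    (a : 𝔄) (U : GaugeField P 0 G) :
    B240 T admB a k U = ∑ n ∈ Icc 1 k, ∑ j ∈ Icc n k,
      ∑ X : (T.sys j).Dom, (if admB j X = true ∧ cls j X = n then (T.B j X (T.ofBackground U) a).re else 0) := by
  classical
  rw [← sum_triangle_comm' k (fun j n => ∑ X : (T.sys j).Dom, (if admB j X = true ∧ cls j X = n then (T.B j X (T.ofBackground U) a).re else 0))]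
  unfold B240
  refine Finset.sum_congr rfl fun j hj => ?_
  rw [Finset.mem_Icc] at hj
  rw [Finset.sum_comm]
  refine Finset.sum_congr rfl fun X _ => ?_
  by_cases hX : admB j X = true
  · obtain ⟨h1, h2⟩ := hcls j hj.1 hj.2 X hX
    rw [if_pos hX, Finset.sum_ite, Finset.sum_const_zero, add_zero, Finset.sum_const]
    have hcard : ((Icc 1 j).filter fun n => admB j X = true ∧ cls j X = n).card = 1 := by
      rw [Finset.card_eq_one]
      refine ⟨cls j X, ?_⟩
      ext n
      simp only [Finset.mem_filter, Finset.mem_Icc, Finset.mem_singleton]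
      constructor
      · rintro ⟨-, -, h⟩; exact h.symm
      · rintro rfl; exact ⟨⟨h1, h2⟩, hX, rfl⟩
    rw [hcard, one_smul]
  · rw [if_neg hX]
    refine (Finset.sum_eq_zero fun n _ => ?_).symm
    rw [if_neg (fun h => hX h.1)]

/-- **★ (2.47) PER CLASS ⇒ (2.48) for `B240`**: with a class map as above, per-class bounds `|b_{j,n}| ≤ B₁·2^{−(j−n)}·V_n` (`1 ≤ n ≤ j ≤ k`; `V_n` = |Γ_n| for n < k, |Γ_k∖Λ_k⁰| for n = k)
and `0 ≤ V_n ≤ Γ_n`, `B₁ ≥ 0`: `|B240 T admB a k U| ≤ 2B₁·Σ_{n=1}^{k} Γ_n` — file 1's binder `h248`.  Kernel = `B14Thm2.bound248_of_247` (the dyadic sum `Σ_{j≥n}2^{−(j−n)} ≤ 2`).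
[cite: Balaban1988Convergent, (2.47)–(2.48) p.264] -/
theorem B240_abs_le_of_ineq247 (cls : (j : ℕ) → (T.sys j).Dom → ℕ) (k : ℕ) (hcls : ∀ j, 1 ≤ j → j ≤ k → ∀ X, admB j X = true → 1 ≤ cls j X ∧ cls j X ≤ j)
    (a : 𝔄) (U : GaugeField P 0 G) {B₁ : ℝ} (hB : 0 ≤ B₁) (V Γ : ℕ → ℝ) (hV : ∀ n, 1 ≤ n → n ≤ k → 0 ≤ V n) (hVΓ : ∀ n, 1 ≤ n → n ≤ k → V n ≤ Γ n)
    (h247 : ∀ n j, 1 ≤ n → n ≤ j → j ≤ k →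
      |∑ X : (T.sys j).Dom, (if admB j X = true ∧ cls j X = n then (T.B j X (T.ofBackground U) a).re else 0)| ≤ B₁ * (2 : ℝ) ^ (-((j : ℝ) - n)) * V n) :
    |B240 T admB a k U| ≤ 2 * B₁ * ∑ n ∈ Icc 1 k, Γ n := by
  rw [B240_eq_sum_classes T admB cls k hcls a U]
  obtain ⟨h1, h2⟩ := bound248_of_247 k (fun j n => ∑ X : (T.sys j).Dom, (if admB j X = true ∧ cls j X = n then (T.B j X (T.ofBackground U) a).re else 0))
    V Γ B₁ hB hV hVΓ h247
  exact h1.trans h2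

end Generic

/-! ## §2. At the ₁₃ objects: file 1's binder `h248` from (2.47) per class on the witness's 𝐁-terms over `𝐃_j` of record -/

section AtRecord13

variable {F : T4Family} {N : ℕ} [NeZero N]
variable (θ : Stage13HParams F N) (p : B12.RunParams) {k : ℕ}

/-- **★★ (2.48) AT NODE 00's STAGE-13 OBJECTS FROM (2.47) PER CLASS**: for the history `s`, the witness `t` (boundary terms `t.B j X`), the fluctuation argument `a`, the (2.41)(i) range
`Sect2.admB … s.Ω s.Λ j` and the configuration `U`: a class map `cls` with values in `[1, j]` on the range, per-class (2.47) bounds with volumes `0 ≤ V_n ≤ Γ_n` and `B₁ ≥ 0` give file 1's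
binder `h248`: `|B240 (sect2TowerOfRecord … s t) (admB of record) a k U| ≤ 2B₁·Σ_{n=1}^{k} Γ_n`. [cite: Balaban1988Convergent, (2.47)–(2.48) p.264, (2.40)–(2.41) p.261] -/
theorem h248_at_record₁₃CoPH_of_ineq247 (s : SeqOfRecord F θ.ν θ.τ9.M (gOfRecord₁₃ F N θ.toStage13Params p) p.K k)
    (t : Sect2.TermValues (F.P p.K) (MatA N) (FluctV N) θ.τ9.M) (a : Tk.SFluct (F.P p.K) (FluctV N)) (U : GaugeField (F.P p.K) 0 (SU N))
    (cls : (j : ℕ) → (Sect2.domSys (F.P p.K) θ.τ9.M j).Dom → ℕ)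
    (hcls : ∀ j, 1 ≤ j → j ≤ k → ∀ X, Sect2.admB (F.P p.K) θ.ν θ.τ9.M (gOfRecord₁₃ F N θ.toStage13Params p) s.Ω s.Λ j (Sect2.domSites (F.P p.K) θ.τ9.M j X) = true →
      1 ≤ cls j X ∧ cls j X ≤ j)
    {B₁ : ℝ} (hB : 0 ≤ B₁) (V Γ : ℕ → ℝ) (hV : ∀ n, 1 ≤ n → n ≤ k → 0 ≤ V n) (hVΓ : ∀ n, 1 ≤ n → n ≤ k → V n ≤ Γ n)
    (h247 : ∀ n j, 1 ≤ n → n ≤ j → j ≤ k →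
      |∑ X : (Sect2.domSys (F.P p.K) θ.τ9.M j).Dom,
          (if Sect2.admB (F.P p.K) θ.ν θ.τ9.M (gOfRecord₁₃ F N θ.toStage13Params p) s.Ω s.Λ j (Sect2.domSites (F.P p.K) θ.τ9.M j X) = true ∧ cls j X = n then
            (t.B j X (Sect2.ofBackgroundC (ιSU N) U) a).re else 0)| ≤ B₁ * (2 : ℝ) ^ (-((j : ℝ) - n)) * V n) :
    |B240 (sect2TowerOfRecord F N (FluctV N) p.K (settingOfRecord₁₃ F N θ.toStage13Params p) (θ.rzAt p s) s t)
        (fun j X => Sect2.admB (F.P p.K) θ.ν θ.τ9.M (gOfRecord₁₃ F N θ.toStage13Params p) s.Ω s.Λ j (Sect2.domSites (F.P p.K) θ.τ9.M j X)) a k U| ≤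
      2 * B₁ * ∑ n ∈ Icc 1 k, Γ n :=
  B240_abs_le_of_ineq247 (sect2TowerOfRecord F N (FluctV N) p.K (settingOfRecord₁₃ F N θ.toStage13Params p) (θ.rzAt p s) s t)
    (fun j X => Sect2.admB (F.P p.K) θ.ν θ.τ9.M (gOfRecord₁₃ F N θ.toStage13Params p) s.Ω s.Λ j (Sect2.domSites (F.P p.K) θ.τ9.M j X)) cls k hcls a U hB V Γ hV hVΓ
    h247

end AtRecord13

end Summit.QuantumFields.YangMills.Theorems.BalabanUVNodesN11Thm2BSideAtRecord13CoPH

end
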